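import Literature.Computability.AlgebraicComplexity.DIP20Lemma313Tail221
import Literature.Computability.AlgebraicComplexity.DIP20Lemma313Tail321
import Literature.Computability.AlgebraicComplexity.DIP20Lemma313Tail330
import Literature.Computability.AlgebraicComplexity.DIP20Lemma313Tail511
import Literature.Computability.AlgebraicComplexity.DIP20HookLikeTails
import HarnessLib

/-!
# Dörfler–Ikenmeyer–Panova 2019, Lemma 3.13 assembled: what remains is six tails

Topic `Literature/Computability/AlgebraicComplexity`; sibling proofs file (D-0014) of
`DIP20MultiplicityObstructions.lean` (named fact `DIP20_lem_3_13`). No new facts, no new definitions.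

J. Dörfler, C. Ikenmeyer, G. Panova, SIAM J. Appl. Algebra Geom. 4 (2020) = arXiv:1901.04576, Lemma 3.13
(arXiv p. 7; TeX `multobs.tex` L480): `a_λ(d[n]) = 0` for the 4-partitions `λ` with `λ̄ ∈ Y` (18 bodies).
State of the tree: the eight hook-like bodies are `DIP20_lem_3_13_of_hookLike` (`DIP20HookLikeTails`),
and the bodies `(2,2,1)`, `(3,2,1)`, `(3,3)`, `(5,1,1)` are the kernel tail computations
`plethysmCoeff_rowDual_tail221/321/330/511_eq_zero` (siblings `DIP20Lemma313Tail*.lean`). This file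
records the reduction **`DIP20_lem_3_13_of_tails`**: the fact follows from the vanishing for the SIX
remaining bodies `(3,3,1)`, `(3,3,2)`, `(3,3,3)`, `(4,3,3)`, `(5,5,5)`, `(6,1,1)` (hypotheses, not facts;
the first two and the last are within reach of the same engine with a larger kernel budget, the other
three need a memoised counter — see the typing cell's handoff).

HONEST FRAMING: bookkeeping of a finite plethysm computation of the toy model; nothing here bears on
permanent versus determinant; VP ≠ VNP is not proved.

## References

* J. Dörfler, C. Ikenmeyer, G. Panova, SIAM J. Appl. Algebra Geom. 4 (2020) = arXiv:1901.04576,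
  Lemma 3.13. [DorflerIkenmeyerPanova2020]

Provenance: val-lit cell, typer val-lit-t07 g2 (DAG row DIP2020-A).
-/

noncomputable section

namespace Literature.Computability.AlgebraicComplexity

open _root_.Literature.NumberTheory.DiophantineGeometry

/-- **Lemma 3.13 from its six remaining tails**: the typed `DIP20_lem_3_13` (all 18 bodies of `Y`, every
inner degree `n`) follows from the vanishing for the bodies `(3,3,1)`, `(3,3,2)`, `(3,3,3)`, `(4,3,3)`,
`(5,5,5)`, `(6,1,1)`; the other twelve are theorems of the tree.
[cite: DorflerIkenmeyerPanova2020, Lemma 3.13 (arXiv p. 7; TeX multobs.tex L480 {lem:vanishingpleth74}; held paper-arxiv-1901.04576 p0007.txt:L71 "Lemma 11")] -/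
theorem DIP20_lem_3_13_of_tails
    (h331 : ∀ (n : ℕ) (μ : Fin 4 → ℕ), Antitone μ → (μ 1, μ 2, μ 3) = (3, 3, 1) →
      plethysmCoeff ℂ (Fin 4) n (rowDual μ) = 0)
    (h332 : ∀ (n : ℕ) (μ : Fin 4 → ℕ), Antitone μ → (μ 1, μ 2, μ 3) = (3, 3, 2) →
      plethysmCoeff ℂ (Fin 4) n (rowDual μ) = 0)
    (h333 : ∀ (n : ℕ) (μ : Fin 4 → ℕ), Antitone μ → (μ 1, μ 2, μ 3) = (3, 3, 3) →
      plethysmCoeff ℂ (Fin 4) n (rowDual μ) = 0)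
    (h433 : ∀ (n : ℕ) (μ : Fin 4 → ℕ), Antitone μ → (μ 1, μ 2, μ 3) = (4, 3, 3) →
      plethysmCoeff ℂ (Fin 4) n (rowDual μ) = 0)
    (h555 : ∀ (n : ℕ) (μ : Fin 4 → ℕ), Antitone μ → (μ 1, μ 2, μ 3) = (5, 5, 5) →
      plethysmCoeff ℂ (Fin 4) n (rowDual μ) = 0)
    (h611 : ∀ (n : ℕ) (μ : Fin 4 → ℕ), Antitone μ → (μ 1, μ 2, μ 3) = (6, 1, 1) →
      plethysmCoeff ℂ (Fin 4) n (rowDual μ) = 0) :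
    DIP20_lem_3_13 := by
  intro n μ hμ ht
  simp only [dipTails47, Finset.mem_insert, Finset.mem_singleton] at ht
  rcases ht with h | h | h | h | h | h | h | h | h | h | h | h | h | h | h | h | h | h
  · exact DIP20_lem_3_13_of_hookLike n μ hμ (by rw [h]; decide)
  · exact DIP20_lem_3_13_of_hookLike n μ hμ (by rw [h]; decide)
  · exact DIP20_lem_3_13_of_hookLike n μ hμ (by rw [h]; decide)
  · exact DIP20_lem_3_13_of_hookLike n μ hμ (by rw [h]; decide)
  · exact DIP20_lem_3_13_of_hookLike n μ hμ (by rw [h]; decide)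
  · obtain ⟨h1, h23⟩ := Prod.mk.inj h
    obtain ⟨h2, h3⟩ := Prod.mk.inj h23
    exact plethysmCoeff_rowDual_tail221_eq_zero n μ hμ h1 h2 h3
  · exact DIP20_lem_3_13_of_hookLike n μ hμ (by rw [h]; decide)
  · exact DIP20_lem_3_13_of_hookLike n μ hμ (by rw [h]; decide)
  · obtain ⟨h1, h23⟩ := Prod.mk.inj h
    obtain ⟨h2, h3⟩ := Prod.mk.inj h23
    exact plethysmCoeff_rowDual_tail321_eq_zero n μ hμ h1 h2 h3
  · obtain ⟨h1, h23⟩ := Prod.mk.inj h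
    obtain ⟨h2, h3⟩ := Prod.mk.inj h23
    exact plethysmCoeff_rowDual_tail330_eq_zero n μ hμ h1 h2 h3
  · exact h331 n μ hμ h
  · exact h332 n μ hμ h
  · exact h333 n μ hμ h
  · exact DIP20_lem_3_13_of_hookLike n μ hμ (by rw [h]; decide)
  · exact h433 n μ hμ h
  · obtain ⟨h1, h23⟩ := Prod.mk.inj h
    obtain ⟨h2, h3⟩ := Prod.mk.inj h23
    exact plethysmCoeff_rowDual_tail511_eq_zero n μ hμ h1 h2 h3
  · exact h555 n μ hμ h
  · exact h611 n μ hμ h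

end Literature.Computability.AlgebraicComplexity
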